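import Summits.Ventures.CertifiedManyBodySolver.Theorems.M3x2EdgeSplitSymReplayOutRouteMFK
import Summits.Ventures.CertifiedManyBodySolver.Theorems.M3x2EdgeSplitSymReplayOutRouteMFP
import HarnessLib

/-!
# SymReplay — PACKED EMISSION for ANY row payload (γ-lite port): `shareRFastMFDP` / `shareRFastMFKP` = `encP` of MFD / MFK

(team lb-sym, cell hub-lb; hub-lb-sym-eng-4 g3, 2026-08-28; ADDITIVE on hub-lb-sym-eng-3 g3's `…OutRouteMFP` (packed emission for the
ℚ-dot enumerator `shareRFastMF`, p664470) and on this seat's `…OutRouteMFD` (dense integer dots) / `…OutRouteMFK` (Kronecker dots);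
nothing landed is touched.)

WHY.  γ-lite (encode the representative term ONCE, read the basis word's code from a tagged bucket, emit packed products — removes
`encP`, 12–19 µs per product) was landed for the ℚ-dot enumerator only; the fast-dot enumerators MFD (β⁺) and MFK (κ) emitted
tree words.  This module makes the two levers STACK: a payload-generic per-row enumerator `rowFastG σ` (any row type `ρ`, any
per-hit step `σ` that emits the concatenated word — `StepConcat σ`), its packed-emission twin `rowFastGP`, the bridge
`rowFastGP_eq : rowFastGP … = encP lo hi (rowFastG …)` under a tagged-bucket hypothesis (`bucketByP_getD`), and the two instances:
**`shareRFastMFDP_eq : shareRFastMFDP … = encP lo hi (shareRFastMFD …)`**, **`shareRFastMFKP_eq : shareRFastMFKP … = encP lo hi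
(shareRFastMFK …)`** (the landed `rowFastFD`/`rowFastFK` ARE `rowFastG` instances by `rfl`), with the fact transports /
closings `energyDensity_ge_of_outroutePMFDP` / `…PMFKP` (= `…PMFD0'` / `…PMFK0` + `OutFactsP0.of_packedEmission`; `…PMF0`'s binder
list with packed facts).  MODULE GRAMMAR (E-class): `out_m : pisZeroT (pcanonNFZHBZT lo hi PackedNF.oracleV3 (shareRFastMFKP momSpecC
cert gbs tabC κ₂ lo hi J L (m / L) (m % L))) = true := by native_decide` (or `…MFDP`), facts of record by `pisZero_of_T`.  Std
axioms; no `native_decide` here.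

HONEST FRAMING: an interpreted replay-COST lever (plumbing that lets two landed levers stack) with its equality proofs; certifies
nothing; no bound of record moves; no summit or crux statement is proved here; nothing here predicts superconductivity.
-/

namespace Summit.Ventures.CertifiedManyBodySolver.Theorems.SymReplay

open Literature.MathematicalPhysics.QuantumLattice
open Literature.MathematicalPhysics.QuantumLattice.HubbardWave0
open Literature.MathematicalPhysics.QuantumLattice.ThermodynamicLimit
open Literature.Probability.LatticeModels
open Literature.MathematicalPhysics.QuantumManyBody.StateRelaxation
open Summit.Ventures.CertifiedManyBodySolver.Theorems.WardSlot

section Generic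

variable {M : Type} [DecidableEq M] [Hashable M] {ρ : Type}

/-- A per-hit step **emits the concatenated word**: whenever it returns a term, the word is `t.2 ++ x.2.2`. -/
def StepConcat (σ : (ℚ × Word) → (ρ × (ℚ × Word)) → Option (ℚ × Word)) : Prop :=
  ∀ t x r, σ t x = some r → r.2 = t.2 ++ x.2.2

/-- **Generic per-row enumeration** over a row payload `ρ` with per-hit step `σ` (the common shape of `rowFastF/FZ/FD/FK`). -/
def rowFastG (S : MomSpec M) (σ : (ℚ × Word) → (ρ × (ℚ × Word)) → Option (ℚ × Word)) (p : QPoly)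
    (wmap : Std.HashMap M (List (ρ × (ℚ × Word)))) (T : List M) (P₂ : Word → Bool) : QPoly :=
  (padj p).flatMap fun t =>
    T.flatMap fun mt =>
      (wmap.getD (S.sub mt (mom S t.2)) []).filterMap fun x => if P₂ (t.2 ++ x.2.2) then σ t x else none

/-- Tag a bucket entry with the packed basis word. -/
def ptagG (lo hi : ℤ × ℤ) (x : ρ × (ℚ × Word)) : (ρ × (ℚ × Word)) × PackedNF.PWord := (x, PackedNF.encW lo hi x.2.2)

/-- **Packed-tagged bucket map** for any payload (the landed `bucketBy` on tagged entries). -/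
def bucketByP (S : MomSpec M) (lo hi : ℤ × ℤ) (xs : List (ρ × (ℚ × Word))) :
    Std.HashMap M (List ((ρ × (ℚ × Word)) × PackedNF.PWord)) :=
  bucketBy (fun xp : (ρ × (ℚ × Word)) × PackedNF.PWord => mom S xp.1.2.2) (xs.map (ptagG lo hi))

/-- **Tagged bucket = bucket, tagged.** -/
theorem bucketByP_getD (S : MomSpec M) (lo hi : ℤ × ℤ) (xs : List (ρ × (ℚ × Word))) (m : M) :
    (bucketByP S lo hi xs).getD m [] = ((bucketBy (fun x : ρ × (ℚ × Word) => mom S x.2.2) xs).getD m []).map (ptagG lo hi) := by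
  unfold bucketByP
  rw [bucketBy_getD, bucketBy_getD, List.filter_map, List.map_reverse]
  rfl

/-- **Generic packed emission**: representative term encoded once, basis code read from the tag, product emitted packed. -/
def rowFastGP (S : MomSpec M) (lo hi : ℤ × ℤ) (σ : (ℚ × Word) → (ρ × (ℚ × Word)) → Option (ℚ × Word)) (p : QPoly)
    (wmapP : Std.HashMap M (List ((ρ × (ℚ × Word)) × PackedNF.PWord))) (T : List M) (P₂ : Word → Bool) : PackedNF.PPoly :=
  (padj p).flatMap fun t =>
    let tP := PackedNF.encW lo hi t.2
    T.flatMap fun mt =>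
      (wmapP.getD (S.sub mt (mom S t.2)) []).filterMap fun xp =>
        if P₂ (t.2 ++ xp.1.2.2) then (σ t xp.1).map fun r => (r.1, tP ++ xp.2) else none

/-- A concatenating step's result, encoded = re-paired with the concatenated codes. -/
theorem step_map_enc (lo hi : ℤ × ℤ) (σ : (ℚ × Word) → (ρ × (ℚ × Word)) → Option (ℚ × Word)) (hσ : StepConcat σ)
    (t : ℚ × Word) (x : ρ × (ℚ × Word)) :
    (σ t x).map (fun r => (r.1, PackedNF.encW lo hi r.2)) =
      (σ t x).map (fun r => (r.1, PackedNF.encW lo hi t.2 ++ PackedNF.encW lo hi x.2.2)) := by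
  cases h : σ t x with
  | none => rfl
  | some r => rw [Option.map_some, Option.map_some, hσ t x r h]; simp [PackedNF.encW, List.map_append]

/-- **Generic row bridge**: on a tagged bucket map, packed emission = encoding of the generic enumeration. -/
theorem rowFastGP_eq (S : MomSpec M) (lo hi : ℤ × ℤ) (σ : (ℚ × Word) → (ρ × (ℚ × Word)) → Option (ℚ × Word))
    (hσ : StepConcat σ) (p : QPoly) (wmap : Std.HashMap M (List (ρ × (ℚ × Word))))
    (wmapP : Std.HashMap M (List ((ρ × (ℚ × Word)) × PackedNF.PWord)))
    (hW : ∀ k, wmapP.getD k [] = (wmap.getD k []).map (ptagG lo hi)) (T : List M) (P₂ : Word → Bool) :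
    rowFastGP S lo hi σ p wmapP T P₂ = PackedNF.encP lo hi (rowFastG S σ p wmap T P₂) := by
  simp only [rowFastGP, rowFastG, PackedNF.encP, List.map_flatMap, hW, List.filterMap_map, List.map_filterMap]
  congr 1; funext t; congr 1; funext mt; congr 1; funext x
  simp only [Function.comp_def, ptagG]
  by_cases hc : P₂ (t.2 ++ x.2.2)
  · simp only [hc, if_true]; exact (step_map_enc lo hi σ hσ t x).symm
  · simp only [hc]; rfl

end Generic

/-! ##### Instances: MFD (dense integer dots) and MFK (Kronecker dots) with packed emission -/

section Instances

variable {M : Type} [DecidableEq M] [Hashable M]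

/-- `stepOptD` emits the concatenated word. -/
theorem stepOptD_concat (aD : List ℤ) (kb : ℚ) : StepConcat (fun t x => stepOptD aD kb t x) := by
  intro t x r h
  dsimp only [stepOptD] at h
  split_ifs at h
  cases h; rfl

/-- `stepOptK` emits the concatenated word. -/
theorem stepOptK_concat (sh mask : ℕ) (Mo : ℤ) (r : ℕ) (aK : KRow) (kb : ℚ) :
    StepConcat (fun t x => stepOptK sh mask Mo r aK kb t x) := by
  intro t x r' h
  dsimp only [stepOptK] at h
  split_ifs at h
  cases h; rfl

/-- The landed dense row enumerator IS a `rowFastG` instance. -/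
theorem rowFastFD_eq_G (S : MomSpec M) (a : QPoly × List ℤ) (wmap : Std.HashMap M (List (List ℤ × (ℚ × Word)))) (kb : ℚ)
    (T : List M) (P₂ : Word → Bool) :
    rowFastFD S a wmap kb T P₂ = rowFastG S (fun t x => stepOptD a.2 kb t x) a.1 wmap T P₂ := rfl

/-- The landed Kronecker row enumerator IS a `rowFastG` instance. -/
theorem rowFastFK_eq_G (S : MomSpec M) (sh mask : ℕ) (Mo : ℤ) (r : ℕ) (a : QPoly × KRow)
    (wmap : Std.HashMap M (List (KRow × (ℚ × Word)))) (kb : ℚ) (T : List M) (P₂ : Word → Bool) :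
    rowFastFK S sh mask Mo r a wmap kb T P₂ = rowFastG S (fun t x => stepOptK sh mask Mo r a.2 kb t x) a.1 wmap T P₂ := rfl

/-- **R-part of sub-module `(i, f)`, dense dots, PACKED emission.** -/
def shareRWithMFDP (S : MomSpec M) (lo hi : ℤ × ℤ) (K : SymCertR) (gbs : List (List QPoly)) (T : List M) (P₂ : Word → Bool) :
    PackedNF.PPoly :=
  (K.gramR.zip gbs).flatMap fun Bg =>
    let D := blockDen Bg.1
    let rd := blockRowsD Bg.1
    let kb : ℚ := -1 * ((Bg.1.moves.length : ℚ) * Bg.1.scale) / ((D : ℚ) * D)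
    let wmapP := bucketByP S lo hi (wflatD (Bg.2.zip rd))
    (Bg.1.reps.zip rd).flatMap fun a => rowFastGP S lo hi (fun t x => stepOptD a.2 kb t x) a.1 wmapP T P₂

/-- **R-part of sub-module `(i, f)`, Kronecker dots, PACKED emission.** -/
def shareRWithMFKP (S : MomSpec M) (lo hi : ℤ × ℤ) (K : SymCertR) (gbs : List (List QPoly)) (T : List M) (P₂ : Word → Bool) :
    PackedNF.PPoly :=
  (K.gramR.zip gbs).flatMap fun Bg =>
    let D := blockDen Bg.1
    let b := blockBits Bg.1
    let Mo := blockAbsBound Bg.1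
    let r := blockWidth Bg.1
    let sh := b * (r - 1)
    let mask := 2 ^ b - 1
    let rk := blockRowsK Bg.1
    let kb : ℚ := -1 * ((Bg.1.moves.length : ℚ) * Bg.1.scale) / ((D : ℚ) * D)
    let wmapP := bucketByP S lo hi (wflatK (Bg.2.zip rk))
    (Bg.1.reps.zip rk).flatMap fun a => rowFastGP S lo hi (fun t x => stepOptK sh mask Mo r a.2 kb t x) a.1 wmapP T P₂

/-- **Sub-module share, dense dots, packed emission** (`= encP lo hi (shareRFastMFD …)`, `shareRFastMFDP_eq`). -/
def shareRFastMFDP (S : MomSpec M) (K : SymCertR) (gbs : List (List QPoly)) (hm : MomTable M) (κ₂ : Word → ℕ)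
    (lo hi : ℤ × ℤ) (J L i f : ℕ) : PackedNF.PPoly :=
  let P := wordPred (inSlotW (momKey S hm) J i)
  let P₂ : Word → Bool := fun w => κ₂ w % L == f
  PackedNF.encP lo hi ((baseShareF K.toSymCert P).filter (wordPred P₂)) ++
  (PackedNF.encP lo hi ((pscale (-1) (K.gramM.flatMap fun B => (gramBlockPoly B).filter P)).filter (wordPred P₂)) ++
    shareRWithMFDP S lo hi K gbs (targetsM hm J i) P₂)

/-- **Sub-module share, Kronecker dots, packed emission** (`= encP lo hi (shareRFastMFK …)`, `shareRFastMFKP_eq`). -/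
def shareRFastMFKP (S : MomSpec M) (K : SymCertR) (gbs : List (List QPoly)) (hm : MomTable M) (κ₂ : Word → ℕ)
    (lo hi : ℤ × ℤ) (J L i f : ℕ) : PackedNF.PPoly :=
  let P := wordPred (inSlotW (momKey S hm) J i)
  let P₂ : Word → Bool := fun w => κ₂ w % L == f
  PackedNF.encP lo hi ((baseShareF K.toSymCert P).filter (wordPred P₂)) ++
  (PackedNF.encP lo hi ((pscale (-1) (K.gramM.flatMap fun B => (gramBlockPoly B).filter P)).filter (wordPred P₂)) ++
    shareRWithMFKP S lo hi K gbs (targetsM hm J i) P₂)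

/-- Block bridge, dense. -/
theorem shareRWithMFDP_eq (S : MomSpec M) (lo hi : ℤ × ℤ) (K : SymCertR) (gbs : List (List QPoly)) (T : List M)
    (P₂ : Word → Bool) : shareRWithMFDP S lo hi K gbs T P₂ = PackedNF.encP lo hi (shareRWithMFD S K gbs T P₂) := by
  simp only [shareRWithMFDP, shareRWithMFD, PackedNF.encP, List.map_flatMap]
  congr 1; funext Bg; congr 1; funext a
  rw [rowFastFD_eq_G]
  exact rowFastGP_eq S lo hi _ (stepOptD_concat _ _) _ _ _ (bucketByP_getD S lo hi _) T P₂

/-- Block bridge, Kronecker. -/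
theorem shareRWithMFKP_eq (S : MomSpec M) (lo hi : ℤ × ℤ) (K : SymCertR) (gbs : List (List QPoly)) (T : List M)
    (P₂ : Word → Bool) : shareRWithMFKP S lo hi K gbs T P₂ = PackedNF.encP lo hi (shareRWithMFK S K gbs T P₂) := by
  simp only [shareRWithMFKP, shareRWithMFK, PackedNF.encP, List.map_flatMap]
  congr 1; funext Bg; congr 1; funext a
  rw [rowFastFK_eq_G]
  exact rowFastGP_eq S lo hi _ (stepOptK_concat _ _ _ _ _ _) _ _ _ (bucketByP_getD S lo hi _) T P₂

/-- **THE BRIDGE (dense, packed emission)**: `shareRFastMFDP … = encP lo hi (shareRFastMFD …)`. -/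
theorem shareRFastMFDP_eq (S : MomSpec M) (K : SymCertR) (gbs : List (List QPoly)) (hm : MomTable M) (κ₂ : Word → ℕ)
    (lo hi : ℤ × ℤ) (J L i f : ℕ) :
    shareRFastMFDP S K gbs hm κ₂ lo hi J L i f = PackedNF.encP lo hi (shareRFastMFD S K gbs hm κ₂ J L i f) := by
  simp only [shareRFastMFDP, shareRFastMFD, PackedNF.encP_append, shareRWithMFDP_eq]

/-- **THE BRIDGE (Kronecker, packed emission)**: `shareRFastMFKP … = encP lo hi (shareRFastMFK …)`. -/
theorem shareRFastMFKP_eq (S : MomSpec M) (K : SymCertR) (gbs : List (List QPoly)) (hm : MomTable M) (κ₂ : Word → ℕ)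
    (lo hi : ℤ × ℤ) (J L i f : ℕ) :
    shareRFastMFKP S K gbs hm κ₂ lo hi J L i f = PackedNF.encP lo hi (shareRFastMFK S K gbs hm κ₂ J L i f) := by
  simp only [shareRFastMFKP, shareRFastMFK, PackedNF.encP_append, shareRWithMFKP_eq]

/-- **CLOSING, dense dots + packed emission** (`…PMF0`'s binders; packed facts over the `J·L` modules). -/
theorem energyDensity_ge_of_outroutePMFDP (Sm : MomSpec M) (K : SymCertR) (hwf : wellFormed K.expand = true)
    (hRok : K.gramR.all (gramBlockROK K.frame) = true) (oP : PackedNF.PWord → PackedNF.PHint) (hm : MomTable M)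
    (κ₂ : Word → ℕ) (J L : ℕ) (hJ : 0 < J) (hL : 0 < L) (lo hi : ℤ × ℤ) (hbox : boxLicence K.frame lo hi = true)
    (hcov : coverM Sm K (K.gramR.map genBasis) hm = true)
    (hfacts : ∀ m, m < J * L → PackedNF.pisZero (PackedNF.pcanonNFZHBZ lo hi oP
      (shareRFastMFDP Sm K (K.gramR.map genBasis) hm κ₂ lo hi J L (m / L) (m % L))) = true) :
    ((symValueR K : ℚ) : ℝ) ≤ energyDensityTT' 1 0 8 (7 / 8) :=
  energyDensity_ge_of_outroutePMFD0' Sm K hwf hRok oP hm κ₂ J L hJ hL lo hi hbox hcov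
    (OutFactsP0.of_packedEmission (fun m => shareRFastMFDP_eq Sm K _ hm κ₂ lo hi J L (m / L) (m % L)) (J * L) 0
      fun m _ hm' => hfacts m (by omega))

/-- **CLOSING, Kronecker dots + packed emission** (`…PMF0`'s binders; packed facts over the `J·L` modules). -/
theorem energyDensity_ge_of_outroutePMFKP (Sm : MomSpec M) (K : SymCertR) (hwf : wellFormed K.expand = true)
    (hRok : K.gramR.all (gramBlockROK K.frame) = true) (oP : PackedNF.PWord → PackedNF.PHint) (hm : MomTable M)
    (κ₂ : Word → ℕ) (J L : ℕ) (hJ : 0 < J) (hL : 0 < L) (lo hi : ℤ × ℤ) (hbox : boxLicence K.frame lo hi = true)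
    (hcov : coverM Sm K (K.gramR.map genBasis) hm = true)
    (hfacts : ∀ m, m < J * L → PackedNF.pisZero (PackedNF.pcanonNFZHBZ lo hi oP
      (shareRFastMFKP Sm K (K.gramR.map genBasis) hm κ₂ lo hi J L (m / L) (m % L))) = true) :
    ((symValueR K : ℚ) : ℝ) ≤ energyDensityTT' 1 0 8 (7 / 8) :=
  energyDensity_ge_of_outroutePMFK0 Sm K hwf hRok oP hm κ₂ J L hJ hL lo hi hbox hcov
    (OutFactsP0.of_packedEmission (fun m => shareRFastMFKP_eq Sm K _ hm κ₂ lo hi J L (m / L) (m % L)) (J * L) 0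
      fun m _ hm' => hfacts m (by omega))

end Instances

end Summit.Ventures.CertifiedManyBodySolver.Theorems.SymReplay
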